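import Mathlib
import Summits.Ventures.PercRepro2.Defs
import Summits.Ventures.PercRepro2.Harris
import Summits.Ventures.PercRepro2.CoinDefs
import Summits.Ventures.PercRepro2.CoinStarDefs
import Summits.Ventures.PercRepro2.CoinLsmCoreDefs
import Summits.Ventures.PercRepro2.CoinLsmCoreU
import Summits.Ventures.PercRepro2.CoinCoreGate
import Summits.Ventures.PercRepro2.CoinOrTailKDefs
import Summits.Ventures.PercRepro2.CoinOrTailKSums
import Summits.Ventures.PercRepro2.CoinOrTailKAlg
import Summits.Ventures.PercRepro2.CoinOrTailKCore
import Summits.Ventures.PercRepro2.CoinOrTailLsmCore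
import Summits.Ventures.PercRepro2.CoinTreeCore
import Summits.Ventures.PercRepro2.CoinKSureGen
import Summits.Ventures.PercRepro2.CoinKSureTailSums
import Summits.Ventures.PercRepro2.CoinChainCover
import Summits.Ventures.PercRepro2.CoinFourAtomMono
import Summits.Ventures.PercRepro2.CoinChainMarkerA
import Summits.Ventures.PercRepro2.CoinChainTower

/-!
# The first marker at the BOTTOM vertex of a pendant OR-tower (blind cell PercRepro2, night-2 g17;
proofs/NIGHT2-DARC.md §57.13)

`v₁` an OR-vertex of `U` entered from ANY `ent₁ ⊆ U` by SURE coins, a tower `rest` of further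
OR-vertices over `insert v₁ U` (any coins) whose entries are the second marker `m₂` or lower tower
vertices, and the free arc's tail `a` an OR-vertex of the tower core with entries among `m₂` and the
tower vertices; the markers `(v₁, m₂)`.  The tower reduction (`OrTower.sum_tower`) peels the
vertices above `v₁`, `sum_gen` / `sum_gen_tail` peel `v₁` (the marker `1[v₁ ∈ W]` becomes the entry
indicator of `ent₁`), and the monotone four-atom sandwich closes — the covering condition is
automatic for the marker at the bottom vertex: **`darc_of_towerMarkerV₁`**, `_swap`,
`darc_of_towerTreeMarkerV₁`.  `darc_of_chainMarkerA'` is the case `rest = []`.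
-/

namespace Summit.Ventures.PercRepro2.Coin

open Classical

section TowerMarker

variable {V : Type*} {E : Type*} [Fintype V] [DecidableEq V] [Fintype E] [DecidableEq E]
  {R : Type*} [Field R] [LinearOrder R] [IsStrictOrderedRing R]
  {arcs : E → Finset (V × V)} {s : V} {U : Finset V} {ent ent₁ : Finset V} {c c₁ : V → E}
  {a v₁ w : V} {rest : List (Finset V × (V → E) × V)}

/-- **THEOREM (row 2′DARC at the top of an OR-tower, the first marker at the BOTTOM vertex).**
`OrTailK arcs s U ent₁ c₁ v₁` with SURE coins and `ent₁` ARBITRARY, `OrTower arcs s (insert v₁ U) rest`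
with every entry of every level equal to `m₂` or outside `U`, `a` an OR-vertex of the tower core with
every entry equal to `m₂` or outside `U` (ANY coins above `v₁`), the cluster law of `U`
log-supermodular, `m₂ ∈ U`, `t, w ∉ insert a (towerCore (insert v₁ U) rest)`, `t, w ≠ s` ⟹
`DARC pr arcs s {t} v₁ m₂ a w`. -/
theorem darc_of_towerMarkerV₁ (pr : E → R) (hp : IsProbVec pr) (hS : SameEnds arcs)
    (h₁ : OrTailK arcs s U ent₁ c₁ v₁) (hT : OrTower arcs s (insert v₁ U) rest)
    (h : OrTailK arcs s (towerCore (insert v₁ U) rest) ent c a)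
    (hsure : ∀ r ∈ ent₁, pr (c₁ r) = 1)
    {m₂ : V} (hm₂ : m₂ ∈ U) (hcovL : ∀ x ∈ rest, ∀ r ∈ x.1, r = m₂ ∨ r ∉ U)
    (hcov : ∀ r ∈ ent, r = m₂ ∨ r ∉ U)
    (hν : ∀ W W', W ⊆ U → W' ⊆ U →
      prob pr (coreLevel arcs s U W) * prob pr (coreLevel arcs s U W') ≤
        prob pr (coreLevel arcs s U (W ∩ W')) * prob pr (coreLevel arcs s U (W ∪ W')))
    {t : V} (htC : t ∉ insert a (towerCore (insert v₁ U) rest)) (hts : t ≠ s) (hws : w ≠ s)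
    (hwC : w ∉ insert a (towerCore (insert v₁ U) rest)) :
    DARC pr arcs s {t} v₁ m₂ a w := by
  have hC := h.closedInCoreU
  have hv₁U : v₁ ∉ U := h₁.a_notin
  have hUC : insert v₁ U ⊆ towerCore (insert v₁ U) rest := subset_towerCore _ rest
  have haC' : a ∉ towerCore (insert v₁ U) rest := h.a_notin
  have hv₁a : v₁ ≠ a := fun e => haC' (e ▸ hUC (Finset.mem_insert_self v₁ U))
  have hm₂a : m₂ ≠ a := fun e => haC' (e ▸ hUC (Finset.mem_insert_of_mem hm₂))
  have hm₂v₁ : m₂ ≠ v₁ := fun e => hv₁U (e ▸ hm₂)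
  have hvert := hT.vertex_notin
  have hv₁v : ∀ x ∈ rest, v₁ ≠ x.2.2 := fun x hx e => hvert x hx (e ▸ Finset.mem_insert_self v₁ U)
  have hm₂v : ∀ x ∈ rest, m₂ ≠ x.2.2 := fun x hx e => hvert x hx (e ▸ Finset.mem_insert_of_mem hm₂)
  have hv₁C : v₁ ∈ insert a (towerCore (insert v₁ U) rest) :=
    Finset.mem_insert_of_mem (hUC (Finset.mem_insert_self v₁ U))
  have hm₂C : m₂ ∈ insert a (towerCore (insert v₁ U) rest) :=
    Finset.mem_insert_of_mem (hUC (Finset.mem_insert_of_mem hm₂))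
  have haC : a ∈ insert a (towerCore (insert v₁ U) rest) := Finset.mem_insert_self _ _
  unfold DARC
  rw [hC.phiC_gate_eq pr hS htC hts hv₁C hm₂C haC hws hwC]
  -- the marker functions and their invariances under `insert a` and under the tower vertices
  have hm1 : ∀ W : Finset V, (fun _ : Finset V => (1 : R)) (insert a W) = (fun _ => (1 : R)) W :=
    fun _ => rfl
  have hm1L : ∀ x ∈ rest, ∀ W : Finset V,
      (fun _ : Finset V => (1 : R)) (insert x.2.2 W) = (fun _ => (1 : R)) W := fun _ _ _ => rfl
  have hm1' : ∀ W : Finset V, (fun _ : Finset V => (1 : R)) (insert v₁ W) = (fun _ => (1 : R)) W :=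
    fun _ => rfl
  have hxa : ∀ W : Finset V, (fun W : Finset V => if v₁ ∈ W then (1 : R) else 0) (insert a W) =
      (fun W : Finset V => if v₁ ∈ W then (1 : R) else 0) W := by
    intro W; simp only [Finset.mem_insert, hv₁a, false_or]
  have hxL : ∀ x ∈ rest, ∀ W : Finset V,
      (fun W : Finset V => if v₁ ∈ W then (1 : R) else 0) (insert x.2.2 W) =
      (fun W : Finset V => if v₁ ∈ W then (1 : R) else 0) W := by
    intro x hx W; simp only [Finset.mem_insert, hv₁v x hx, false_or]
  have hya : ∀ W : Finset V, (fun W : Finset V => if m₂ ∈ W then (1 : R) else 0) (insert a W) =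
      (fun W : Finset V => if m₂ ∈ W then (1 : R) else 0) W := by
    intro W; simp only [Finset.mem_insert, hm₂a, false_or]
  have hyL : ∀ x ∈ rest, ∀ W : Finset V,
      (fun W : Finset V => if m₂ ∈ W then (1 : R) else 0) (insert x.2.2 W) =
      (fun W : Finset V => if m₂ ∈ W then (1 : R) else 0) W := by
    intro x hx W; simp only [Finset.mem_insert, hm₂v x hx, false_or]
  have hya' : ∀ W : Finset V, (fun W : Finset V => if m₂ ∈ W then (1 : R) else 0) (insert v₁ W) =
      (fun W : Finset V => if m₂ ∈ W then (1 : R) else 0) W := by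
    intro W; simp only [Finset.mem_insert, hm₂v₁, false_or]
  have hxya : ∀ W : Finset V,
      (fun W : Finset V => (if v₁ ∈ W then (1 : R) else 0) * (if m₂ ∈ W then (1 : R) else 0))
        (insert a W) =
      (fun W : Finset V => (if v₁ ∈ W then (1 : R) else 0) * (if m₂ ∈ W then (1 : R) else 0)) W := by
    intro W; simp only [Finset.mem_insert, hv₁a, hm₂a, false_or]
  have hxyL : ∀ x ∈ rest, ∀ W : Finset V,
      (fun W : Finset V => (if v₁ ∈ W then (1 : R) else 0) * (if m₂ ∈ W then (1 : R) else 0))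
        (insert x.2.2 W) =
      (fun W : Finset V => (if v₁ ∈ W then (1 : R) else 0) * (if m₂ ∈ W then (1 : R) else 0)) W := by
    intro x hx W; simp only [Finset.mem_insert, hv₁v x hx, hm₂v x hx, false_or]
  -- the marker `1[v₁ ∈ W]` vanishes off `v₁` and is `1` on `insert v₁ W`
  have hg0 : ∀ W : Finset V, v₁ ∉ W →
      (fun W : Finset V => if v₁ ∈ W then (1 : R) else 0) W = 0 := by
    intro W hW; simp only [hW, if_false]
  have hg1 : ∀ W : Finset V, v₁ ∉ W →
      (fun W : Finset V => if v₁ ∈ W then (1 : R) else 0) (insert v₁ W) = (fun _ => (1 : R)) W := by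
    intro W _; simp only [Finset.mem_insert_self, if_true]
  have hq0 : ∀ W : Finset V, v₁ ∉ W →
      (fun W : Finset V => (if v₁ ∈ W then (1 : R) else 0) * (if m₂ ∈ W then (1 : R) else 0)) W
        = 0 := by
    intro W hW; simp only [hW, if_false, zero_mul]
  have hq1 : ∀ W : Finset V, v₁ ∉ W →
      (fun W : Finset V => (if v₁ ∈ W then (1 : R) else 0) * (if m₂ ∈ W then (1 : R) else 0))
          (insert v₁ W) =
        (fun W : Finset V => if m₂ ∈ W then (1 : R) else 0) W := by
    intro W _
    simp only [Finset.mem_insert_self, if_true, one_mul, Finset.mem_insert, hm₂v₁, false_or]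
  -- the level reduction over `a` (core `towerCore (insert v₁ U) rest`)
  have eΛ := h.sum_R_eq pr t (fun _ => (1 : R)) hm1
  have eFa := h.sum_R_eq pr t (fun W => if v₁ ∈ W then (1 : R) else 0) hxa
  have eFb := h.sum_R_eq pr t (fun W => if m₂ ∈ W then (1 : R) else 0) hya
  have eM := h.sum_G_eq (w := w) pr t (fun _ => (1 : R)) hm1
  have eX := h.sum_G_eq (w := w) pr t (fun W => if v₁ ∈ W then (1 : R) else 0) hxa
  have eY := h.sum_G_eq (w := w) pr t (fun W => if m₂ ∈ W then (1 : R) else 0) hya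
  have eXY := h.sum_G_eq (w := w) pr t
    (fun W => (if v₁ ∈ W then (1 : R) else 0) * (if m₂ ∈ W then (1 : R) else 0)) hxya
  simp only [mul_one] at eΛ eM
  rw [eΛ, eFa, eFb, eM, eX, eY, eXY]
  set A : Finset V → R :=
    fun X => prob pr (coreAvoidEvent arcs s t (insert a (towerCore (insert v₁ U) rest)) X) with hAdef
  obtain ⟨hA0, hAmono, hAlsm⟩ :=
    OrTailU.head_props (U := towerCore (insert v₁ U) rest) (a := a) pr hp hS t
  have hp0 := hp.nonneg
  have hp1 := hp.le_one
  set FR : Finset V → R := rValK A pr ent c a with hFR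
  set FG : Finset V → R := gValK A pr ent c a w with hFG
  -- the tower reduction (the vertices above `v₁`; core `insert v₁ U`)
  have tΛ := hT.sum_tower pr FR (fun _ => (1 : R)) hm1L
  have tFa := hT.sum_tower pr FR (fun W => if v₁ ∈ W then (1 : R) else 0) hxL
  have tFb := hT.sum_tower pr FR (fun W => if m₂ ∈ W then (1 : R) else 0) hyL
  have tM := hT.sum_tower pr FG (fun _ => (1 : R)) hm1L
  have tX := hT.sum_tower pr FG (fun W => if v₁ ∈ W then (1 : R) else 0) hxL
  have tY := hT.sum_tower pr FG (fun W => if m₂ ∈ W then (1 : R) else 0) hyL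
  have tXY := hT.sum_tower pr FG
    (fun W => (if v₁ ∈ W then (1 : R) else 0) * (if m₂ ∈ W then (1 : R) else 0)) hxyL
  simp only [mul_one] at tΛ tM
  rw [tΛ, tFa, tFb, tM, tX, tY, tXY]
  set TR : Finset V → R := towerVal pr rest FR with hTR
  set TG : Finset V → R := towerVal pr rest FG with hTG
  -- the level reduction over `v₁` (core `U`)
  have fΛ := h₁.sum_gen pr TR (fun _ => (1 : R)) hm1'
  have fFa := h₁.sum_gen_tail pr TR (fun W => if v₁ ∈ W then (1 : R) else 0) (fun _ => (1 : R))
    hg0 hg1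
  have fFb := h₁.sum_gen pr TR (fun W => if m₂ ∈ W then (1 : R) else 0) hya'
  have fM := h₁.sum_gen pr TG (fun _ => (1 : R)) hm1'
  have fX := h₁.sum_gen_tail pr TG (fun W => if v₁ ∈ W then (1 : R) else 0) (fun _ => (1 : R))
    hg0 hg1
  have fY := h₁.sum_gen pr TG (fun W => if m₂ ∈ W then (1 : R) else 0) hya'
  have fXY := h₁.sum_gen_tail pr TG
    (fun W => (if v₁ ∈ W then (1 : R) else 0) * (if m₂ ∈ W then (1 : R) else 0))
    (fun W => if m₂ ∈ W then (1 : R) else 0) hq0 hq1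
  simp only [mul_one] at fΛ fFa fM fX
  rw [fΛ, fFa, fFb, fM, fX, fY, fXY]
  -- the closures
  set ν : Finset V → R := fun W => prob pr (coreLevel arcs s U W) with hνdef
  have hν0 : ∀ W, 0 ≤ ν W := fun W => prob_nonneg hp _
  set x : Finset V → R := fun W => if ∃ r ∈ ent₁, r ∈ W then (1 : R) else 0 with hxdef
  set y : Finset V → R := fun W => if m₂ ∈ W then (1 : R) else 0 with hydef
  set G : Finset V → R := fun W => ν W * closeB ent₁ v₁ TR W with hGdef
  set G' : Finset V → R := fun W => ν W * closeB ent₁ v₁ TG W with hG'def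
  have cΛ : (∑ W ∈ U.powerset, ν W *
      (tailWtK pr ent₁ c₁ W * TR W + (1 - tailWtK pr ent₁ c₁ W) * TR (W ∪ {v₁}))) =
      ∑ W ∈ U.powerset, G W :=
    Finset.sum_congr rfl fun W _ => by
      simp only [hGdef]; rw [closeB_of_sure pr c₁ v₁ TR hsure W]
  have cFa : (∑ W ∈ U.powerset, ν W * ((1 - tailWtK pr ent₁ c₁ W) * TR (W ∪ {v₁}))) =
      ∑ W ∈ U.powerset, G W * x W :=
    Finset.sum_congr rfl fun W _ => by
      simp only [hGdef, hxdef]; rw [closeB_of_sure_tail pr c₁ v₁ TR hsure W]; ring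
  have cFb : (∑ W ∈ U.powerset, ν W *
      (tailWtK pr ent₁ c₁ W * TR W + (1 - tailWtK pr ent₁ c₁ W) * TR (W ∪ {v₁})) *
        (if m₂ ∈ W then (1 : R) else 0)) = ∑ W ∈ U.powerset, G W * y W :=
    Finset.sum_congr rfl fun W _ => by
      simp only [hGdef, hydef]; rw [closeB_of_sure pr c₁ v₁ TR hsure W]
  have cM : (∑ W ∈ U.powerset, ν W *
      (tailWtK pr ent₁ c₁ W * TG W + (1 - tailWtK pr ent₁ c₁ W) * TG (W ∪ {v₁}))) =
      ∑ W ∈ U.powerset, G' W :=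
    Finset.sum_congr rfl fun W _ => by
      simp only [hG'def]; rw [closeB_of_sure pr c₁ v₁ TG hsure W]
  have cX : (∑ W ∈ U.powerset, ν W * ((1 - tailWtK pr ent₁ c₁ W) * TG (W ∪ {v₁}))) =
      ∑ W ∈ U.powerset, G' W * x W :=
    Finset.sum_congr rfl fun W _ => by
      simp only [hG'def, hxdef]; rw [closeB_of_sure_tail pr c₁ v₁ TG hsure W]; ring
  have cY : (∑ W ∈ U.powerset, ν W *
      (tailWtK pr ent₁ c₁ W * TG W + (1 - tailWtK pr ent₁ c₁ W) * TG (W ∪ {v₁})) *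
        (if m₂ ∈ W then (1 : R) else 0)) = ∑ W ∈ U.powerset, G' W * y W :=
    Finset.sum_congr rfl fun W _ => by
      simp only [hG'def, hydef]; rw [closeB_of_sure pr c₁ v₁ TG hsure W]
  have cXY : (∑ W ∈ U.powerset, ν W * ((1 - tailWtK pr ent₁ c₁ W) * TG (W ∪ {v₁})) *
        (if m₂ ∈ W then (1 : R) else 0)) = ∑ W ∈ U.powerset, G' W * (x W * y W) :=
    Finset.sum_congr rfl fun W _ => by
      simp only [hG'def, hxdef, hydef]; rw [closeB_of_sure_tail pr c₁ v₁ TG hsure W]; ring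
  rw [cΛ, cFa, cFb, cM, cX, cY, cXY]
  -- the hypotheses of the monotone four-atom sandwich
  have hFR0 : ∀ W, 0 ≤ FR W := fun W => rValK_nonneg hp0 hp1 hA0 ent c a W
  have hFG0 : ∀ W, 0 ≤ FG W := fun W => gValK_nonneg hp0 hp1 hA0 ent c a w W
  have hFRlsm : ∀ s t : Finset V, FR s * FR t ≤ FR (s ∩ t) * FR (s ∪ t) :=
    fun s t => rValK_mul_le_all A pr ent c a hp0 hp1 hA0 hAlsm hAmono s t
  have hFGlsm : ∀ s t : Finset V, FG s * FG t ≤ FG (s ∩ t) * FG (s ∪ t) :=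
    fun s t => gValK_mul_le_all A pr ent c a w hp0 hp1 hA0 hAlsm hAmono s t
  have hFRmono : ∀ s t : Finset V, s ⊆ t → FR t ≤ FR s :=
    fun s t hst => rValK_antitone hp0 hp1 hAmono ent c a hst
  have hFGmono : ∀ s t : Finset V, s ⊆ t → FG t ≤ FG s :=
    fun s t hst => gValK_antitone hp0 hp1 hAmono ent c a w hst
  have hFGle : ∀ W, FG W ≤ FR W := fun W => gValK_le_rValK hp0 hp1 hAmono ent c a w W
  obtain ⟨hTR0, hTRlsm, hTRmono⟩ := towerVal_props pr hp0 hp1 rest FR hFR0 hFRlsm hFRmono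
  obtain ⟨hTG0, hTGlsm, hTGmono⟩ := towerVal_props pr hp0 hp1 rest FG hFG0 hFGlsm hFGmono
  have hTGle : ∀ W, TG W ≤ TR W := fun W => towerVal_head_le pr hp0 hp1 rest hFGle W
  have hG0 : ∀ W, 0 ≤ G W := fun W => mul_nonneg (hν0 W) (closeB_nonneg ent₁ v₁ TR hTR0 W)
  have hG'0 : ∀ W, 0 ≤ G' W := fun W => mul_nonneg (hν0 W) (closeB_nonneg ent₁ v₁ TG hTG0 W)
  have hx01 : ∀ W, x W = 0 ∨ x W = 1 := by
    intro W; simp only [hxdef]; split_ifs <;> simp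
  have hy01 : ∀ W, y W = 0 ∨ y W = 1 := by
    intro W; simp only [hydef]; split_ifs <;> simp
  have hxm : ∀ s t : Finset V, s ⊆ t → x s ≤ x t := by
    intro s t hst
    simp only [hxdef]
    by_cases hs : ∃ r ∈ ent₁, r ∈ s
    · obtain ⟨r, hr, hrs⟩ := hs
      rw [if_pos ⟨r, hr, hrs⟩, if_pos ⟨r, hr, hst hrs⟩]
    · rw [if_neg hs]; split_ifs <;> norm_num
  have hym : ∀ s t : Finset V, s ⊆ t → y s ≤ y t := by
    intro s t hst
    simp only [hydef]
    by_cases hs : m₂ ∈ s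
    · rw [if_pos hs, if_pos (hst hs)]
    · rw [if_neg hs]; split_ifs <;> norm_num
  have wLL : ∀ s ⊆ U, ∀ t ⊆ U, G s * G t ≤ G (s ∩ t) * G (s ∪ t) := by
    intro s hs t ht
    have hs' : v₁ ∉ s := fun hx => hv₁U (hs hx)
    have ht' : v₁ ∉ t := fun hx => hv₁U (ht hx)
    simp only [hGdef]
    calc ν s * closeB ent₁ v₁ TR s * (ν t * closeB ent₁ v₁ TR t)
        = (ν s * ν t) * (closeB ent₁ v₁ TR s * closeB ent₁ v₁ TR t) := by ring
      _ ≤ (ν (s ∩ t) * ν (s ∪ t)) * (closeB ent₁ v₁ TR (s ∩ t) * closeB ent₁ v₁ TR (s ∪ t)) :=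
          mul_le_mul (hν s t hs ht) (closeB_lsm ent₁ v₁ TR hTR0 hTRlsm hTRmono hs' ht')
            (mul_nonneg (closeB_nonneg ent₁ v₁ TR hTR0 _) (closeB_nonneg ent₁ v₁ TR hTR0 _))
            (mul_nonneg (hν0 _) (hν0 _))
      _ = _ := by ring
  have wMM : ∀ s ⊆ U, ∀ t ⊆ U, G' s * G' t ≤ G' (s ∩ t) * G' (s ∪ t) := by
    intro s hs t ht
    have hs' : v₁ ∉ s := fun hx => hv₁U (hs hx)
    have ht' : v₁ ∉ t := fun hx => hv₁U (ht hx)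
    simp only [hG'def]
    calc ν s * closeB ent₁ v₁ TG s * (ν t * closeB ent₁ v₁ TG t)
        = (ν s * ν t) * (closeB ent₁ v₁ TG s * closeB ent₁ v₁ TG t) := by ring
      _ ≤ (ν (s ∩ t) * ν (s ∪ t)) * (closeB ent₁ v₁ TG (s ∩ t) * closeB ent₁ v₁ TG (s ∪ t)) :=
          mul_le_mul (hν s t hs ht) (closeB_lsm ent₁ v₁ TG hTG0 hTGlsm hTGmono hs' ht')
            (mul_nonneg (closeB_nonneg ent₁ v₁ TG hTG0 _) (closeB_nonneg ent₁ v₁ TG hTG0 _))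
            (mul_nonneg (hν0 _) (hν0 _))
      _ = _ := by ring
  have hle : ∀ W ∈ U.powerset, G' W ≤ G W := fun W _ =>
    mul_le_mul_of_nonneg_left (closeB_le_closeB ent₁ v₁ hTGle W) (hν0 W)
  have h00 : ∀ W ∈ U.powerset, x W = 0 → y W = 0 → G' W = G W := by
    intro W hW hx hy
    have hWU : W ⊆ U := Finset.mem_powerset.1 hW
    have hno₁ : ¬ ∃ r ∈ ent₁, r ∈ W := by
      intro hex
      simp only [hxdef, if_pos hex] at hx
      exact one_ne_zero hx
    have hm₂W : m₂ ∉ W := by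
      intro hmem
      simp only [hydef, if_pos hmem] at hy
      exact one_ne_zero hy
    have hnoL : ∀ z ∈ rest, ∀ r ∈ z.1, r ∉ W := by
      intro z hz r hr hrW
      rcases hcovL z hz r hr with rfl | hrU
      · exact hm₂W hrW
      · exact hrU (hWU hrW)
    have hno : ∀ r ∈ ent, r ∉ W := by
      intro r hr hrW
      rcases hcov r hr with rfl | hrU
      · exact hm₂W hrW
      · exact hrU (hWU hrW)
    simp only [hGdef, hG'def]
    rw [closeB_of_no_entry ent₁ v₁ TR hno₁, closeB_of_no_entry ent₁ v₁ TG hno₁]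
    simp only [hTR, hTG]
    rw [towerVal_of_no_entry pr rest FR hnoL, towerVal_of_no_entry pr rest FG hnoL]
    simp only [hFR, hFG]
    rw [gValK_eq_rValK_of_no_entry A pr c a w hno]
  exact fourAtom_functional_nonneg_mono U G G' x y hG0 hG'0 hx01 hy01 hxm hym wLL wMM hle h00

/-- **The mirror: markers `(m₂, v₁)`.** -/
theorem darc_of_towerMarkerV₁_swap (pr : E → R) (hp : IsProbVec pr) (hS : SameEnds arcs)
    (h₁ : OrTailK arcs s U ent₁ c₁ v₁) (hT : OrTower arcs s (insert v₁ U) rest)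
    (h : OrTailK arcs s (towerCore (insert v₁ U) rest) ent c a)
    (hsure : ∀ r ∈ ent₁, pr (c₁ r) = 1)
    {m₂ : V} (hm₂ : m₂ ∈ U) (hcovL : ∀ x ∈ rest, ∀ r ∈ x.1, r = m₂ ∨ r ∉ U)
    (hcov : ∀ r ∈ ent, r = m₂ ∨ r ∉ U)
    (hν : ∀ W W', W ⊆ U → W' ⊆ U →
      prob pr (coreLevel arcs s U W) * prob pr (coreLevel arcs s U W') ≤
        prob pr (coreLevel arcs s U (W ∩ W')) * prob pr (coreLevel arcs s U (W ∪ W')))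
    {t : V} (htC : t ∉ insert a (towerCore (insert v₁ U) rest)) (hts : t ≠ s) (hws : w ≠ s)
    (hwC : w ∉ insert a (towerCore (insert v₁ U) rest)) :
    DARC pr arcs s {t} m₂ v₁ a w :=
  (darc_swap pr arcs s {t} v₁ m₂ a w).1
    (darc_of_towerMarkerV₁ pr hp hS h₁ hT h hsure hm₂ hcovL hcov hν htC hts hws hwC)

/-- **COROLLARY (out-tree core).** -/
theorem darc_of_towerTreeMarkerV₁ (pr : E → R) (hp : IsProbVec pr) (hS : SameEnds arcs)
    (h₁ : OrTailK arcs s U ent₁ c₁ v₁) (hT : OrTower arcs s (insert v₁ U) rest)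
    (h : OrTailK arcs s (towerCore (insert v₁ U) rest) ent c a)
    {cT : V → E} {par : V → V} {rk : V → ℕ} (hTr : TreeCore arcs s U cT par rk)
    (hsure : ∀ r ∈ ent₁, pr (c₁ r) = 1)
    {m₂ : V} (hm₂ : m₂ ∈ U) (hcovL : ∀ x ∈ rest, ∀ r ∈ x.1, r = m₂ ∨ r ∉ U)
    (hcov : ∀ r ∈ ent, r = m₂ ∨ r ∉ U)
    {t : V} (htC : t ∉ insert a (towerCore (insert v₁ U) rest)) (hts : t ≠ s) (hws : w ≠ s)
    (hwC : w ∉ insert a (towerCore (insert v₁ U) rest)) :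
    DARC pr arcs s {t} v₁ m₂ a w :=
  darc_of_towerMarkerV₁ pr hp hS h₁ hT h hsure hm₂ hcovL hcov (hTr.coreLevel_lsm pr hp) htC hts
    hws hwC

end TowerMarker

end Summit.Ventures.PercRepro2.Coin
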